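/-
Copyright (c) 2026 the pub-hodgecm-mathlib formalisation cell (harness21).  Prover seat hodgecm-mathlib-B-p14 (g36): road «S3-tree» (chair F0P3a-plan (g11); T10-42 (3) S3-res capital),
brick T1e «VALENCIES», TAME RAMIFIED EDITION R4 = THE ASSEMBLY: the tame-ramified `U(3)` lattice graph is `(q+1)`-REGULAR (plug shape of ★ `TreeDisplacementLayerCount` ED. 2) and its
spheres have `(q+1)·q^{m−1}` vertices (given tree-ness); 2026-09-01.  Twin of ★ V4 `UnitaryLatticeTreeValency`; sequel of ★ R2b and R3.
-/
import Literature.NumberTheory.Automorphic.UnitaryLatticeTreeRootStarCountOfInvolution   -- ★ T1e R2b (B-p14 (g36)): `ncard_neighborSet_of_isSelfDualLattice_of_ramified` (`q + 1`), `finite_…_of_trace`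
import Literature.NumberTheory.Automorphic.UnitaryLatticeTreeTypeTwoStarCountRamified    -- ★ T1e R3 (B-p14 (g36)): `ncard_neighborSet_of_isVertexLattice_two_of_ramified` (`q + 1`), `finite_…_of_neg`
import Literature.NumberTheory.Automorphic.UnitaryLatticeTreeValency                      -- ★ T1e V4 (B-p14 (g36)): `exists_typeFun`, `typeFun_eq_one_iff`; brings ★ `TreeDisplacement.ncard_sphere_eq_of_biregular'`
import HarnessLib

/-!
# The lattice graph of a hermitian space — T1e FILE R4: THE TAME-RAMIFIED `U(3)` LATTICE GRAPH IS `(q+1)`-REGULAR; ITS SPHERES (Tits 1979 §2.4; Serre, *Trees* II.1.1)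

Topic `NumberTheory/Automorphic`; namespace `Literature.NumberTheory.Automorphic.UnitaryLatticeTree`.  THEOREMS ONLY (no definition, no instance, no notation, no named fact,
no `sorry`); kernel lane.  Cell `pub/hodgecm-mathlib` (D-0151), crux H413 = `stmt-HodgeConjecture-24833`; road «S3-tree», brick T1e «VALENCIES», TAME RAMIFIED EDITION (S3-res
capital, chair T10-42 (3)).  THE SETTING («tamely ramified place» in the cell's datum-free currency): `σ` an involution of `K` preserving `v`, `σϖ = −ϖ` for the uniformiser `ϖ`,
`σ` residually trivial (`hres : |σx − x| < 1` on `𝒪`), `|2| = 1`, and the first-order norm surjectivity `hnorm` on `σ`-fixed one-units (Hensel; the binder of ★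
`forall_isVertexLattice_two_exists_mapGL_N₁_eq_of_neg`, F0P3a-p07).  ★ R2b: every self-dual vertex has `q + 1` neighbours (the residual CONIC); ★ R3: every type-two vertex has
`q + 1` neighbours (the residual pairing is ALTERNATING, the star is `ℙ¹(𝓀)`); `q = |𝓀[K]|` (at a ramified place the residue field of `K` is that of the fixed field).  HERE:

* §1 `isVertexLattice_two_of_not_isSelfDualLattice_of_v`, `typeFun_ne_of_adj_of_v` (datum-free editions of ★ V4 §1: types `0`/`2`, types alternate along edges).
* §2 **`finite_neighborSet_of_ramified`** (`hnb`), **`ncard_neighborSet_of_ramified : (G.neighborSet v).ncard = Nat.card 𝓀[K] + 1` for EVERY vertex `v`** — the graph is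
  `(q+1)`-REGULAR = the local index `(q+1, q+1)` of the ramified quasi-split `U(3)` [Tits1979, §2.4]; `ncard_neighborSet_eq_typeFun_of_ramified` (the `hdeg` plug with `q := (q, q)`).
* §3 **`ncard_sphere_of_ramified (hT) (r) (hm : 1 ≤ m) : #{v | dist(r,v) = m} = (q + 1) · q^{m−1}`** for EVERY vertex `r`, GIVEN tree-ness `hT : G.IsTree` (★ `isTree_latticeGraph_three` is
  proved under the UNRAMIFIED datum only — its `latticeParent` specs use the Cartan decomposition of the datum; at a ramified place tree-ness is a BINDER here, honest label), and
  `ncard_sphere_two_of_ramified : #S₂(r) = q² + q`.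

HONEST LABEL: HC_CM is proved only modulo the 2 remaining named inputs (hLiu418 24832, h413 24833) until rung 0 closes; nothing printed is asserted here; ramified places belong to
the residue letter S3-res; the sphere counts of §3 are conditional on the tree binder `hT`.

## References
* [Tits1979] J. Tits, *Reductive groups over local fields*, PSPM 33.1 (1979), §2.4 (ramified quasi-split `U(3)`: both vertices special, local index `(q+1, q+1)`), §3.5.
* [BruhatTits1972] F. Bruhat, J. Tits, *Groupes réductifs sur un corps local I*, Publ. Math. IHÉS 41 (1972), §10.
* [Serre1980Trees] J.-P. Serre, *Trees* (1980), Ch. II §1.1; Ch. I §2.3 (spheres of a regular tree).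
* [Jacobowitz1962] R. Jacobowitz, *Hermitian forms over local fields*, Amer. J. Math. 84 (1962), §7–§8.
-/

set_option autoImplicit false

noncomputable section

open scoped Valued WithZero Matrix MatrixGroups

namespace Literature.NumberTheory.Automorphic.UnitaryLatticeTree

open Literature.NumberTheory.Automorphic Literature.NumberTheory.Automorphic.HermitianLattice
open Literature.NumberTheory.Automorphic.CartanUnique Literature.Combinatorics.SimpleGraph

variable {K : Type*} [Field K] [Valued K ℤᵐ⁰] {σ : K →+* K} {ϖ : K}

/-! ## §1 Type functions — datum-free -/

/-- A vertex that is not self-dual is of type `2` (types are `0` or `2` at `N = 3`; any valuation-preserving `σ`, any uniformiser). [cite: BruhatTits1972, §10] [cite: Tits1979, §2.4] -/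
theorem isVertexLattice_two_of_not_isSelfDualLattice_of_v (hvσ : ∀ a, Valued.v (σ a) = Valued.v a) (hϖ : Valued.v ϖ = WithZero.exp (-1 : ℤ))
    (v : {M : Submodule 𝒪[K] (Fin 3 → K) // IsVertex σ ϖ ((StdForm.antidiagonal 3).over K) M}) (hv : ¬ IsSelfDualLattice σ ϖ ((StdForm.antidiagonal 3).over K) v.1) : IsVertexLattice σ ϖ ((StdForm.antidiagonal 3).over K) 2 v.1 := by
  obtain ⟨d, hdv⟩ := v.2
  rcases type_eq_zero_or_two_of_isVertexLattice_three hvσ hϖ v_det_antidiagonal_three hdv with rfl | rfl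
  · exact absurd hdv hv
  · exact hdv

/-- **TYPES DIFFER ALONG EDGES** (datum-free: any valuation-preserving `σ`, any uniformiser) — the hypothesis `hc` of ★ `TreeDisplacementLayerCount` for any type function.
[cite: BruhatTits1972, §10] [cite: Serre1980Trees, I.2.3] -/
theorem typeFun_ne_of_adj_of_v (hvσ : ∀ a, Valued.v (σ a) = Valued.v a) (hϖ : Valued.v ϖ = WithZero.exp (-1 : ℤ))
    {c : {M : Submodule 𝒪[K] (Fin 3 → K) // IsVertex σ ϖ ((StdForm.antidiagonal 3).over K) M} → Fin 2} (hc0 : ∀ v, c v = 0 ↔ IsSelfDualLattice σ ϖ ((StdForm.antidiagonal 3).over K) v.1) :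
    ∀ v w, (latticeGraph σ ϖ ((StdForm.antidiagonal 3).over K)).Adj v w → c v ≠ c w := by
  intro v w h hEq
  have halt := isSelfDualLattice_iff_not_isSelfDualLattice_of_adj_of_v hvσ hϖ h
  by_cases hv : IsSelfDualLattice σ ϖ ((StdForm.antidiagonal 3).over K) v.1
  · exact (halt.1 hv) ((hc0 w).1 (hEq ▸ (hc0 v).2 hv))
  · have hw : IsSelfDualLattice σ ϖ ((StdForm.antidiagonal 3).over K) w.1 := by
      by_contra hw; exact hv (halt.2 hw)
    exact hv ((hc0 v).1 (hEq ▸ (hc0 w).2 hw))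

/-! ## §2 The tame-ramified lattice graph is `(q+1)`-regular -/

/-- **Every star of the tame-ramified `U(3)` lattice graph is finite** (finite residue field) — the `hnb` plug of ★ `TreeDisplacementLayerCount`. [cite: BruhatTits1972, §10] -/
theorem finite_neighborSet_of_ramified (hσ : ∀ x, σ (σ x) = x) (hvσ : ∀ a, Valued.v (σ a) = Valued.v a) (hσϖ : σ ϖ = -ϖ) (hϖ : Valued.v ϖ = WithZero.exp (-1 : ℤ)) (hres : ∀ x : K, Valued.v x ≤ 1 → Valued.v (σ x - x) < 1) (h2 : Valued.v (2 : K) = 1) (hnorm : ∀ u : K, σ u = u → Valued.v (u - 1) < 1 → ∃ z : K, z * σ z = u ∧ Valued.v (z - 1) ≤ Valued.v (u - 1)) [Finite 𝓀[K]] (v : {M : Submodule 𝒪[K] (Fin 3 → K) // IsVertex σ ϖ ((StdForm.antidiagonal 3).over K) M}) :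
    ((latticeGraph σ ϖ ((StdForm.antidiagonal 3).over K)).neighborSet v).Finite := by
  by_cases hv : IsSelfDualLattice σ ϖ ((StdForm.antidiagonal 3).over K) v.1
  · have hσO : ∀ x : 𝒪[K], σ x ∈ 𝒪[K] := fun x => by change Valued.v (σ x) ≤ 1; rw [hvσ]; exact x.2
    have hσk : ∀ x : 𝒪[K], IsLocalRing.residue 𝒪[K] ⟨σ x, hσO x⟩ = (RingHom.id 𝓀[K]) (IsLocalRing.residue 𝒪[K] x) := fun x =>
      residue_eq_of_v_sub_lt_one (hres x x.2)
    obtain ⟨t, ht, htσ⟩ := exists_traceElem_of_v_two_eq_one (σ := σ) h2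
    exact finite_neighborSet_of_isSelfDualLattice_of_trace hσ hvσ hϖ ⟨t, ht, htσ⟩ (isVertexLattice_two_N₁_of_neg hσϖ hϖ) hσO (RingHom.id _) hσk v hv
  · exact finite_neighborSet_of_isVertexLattice_two_of_neg hvσ hσϖ hϖ hres (forall_isVertexLattice_two_exists_mapGL_N₁_eq_of_neg hσ hvσ hϖ hσϖ hres h2 hnorm) v
      (isVertexLattice_two_of_not_isSelfDualLattice_of_v hvσ hϖ v hv)

/-- **THE TAME-RAMIFIED `U(3)` LATTICE GRAPH IS `(q+1)`-REGULAR**: EVERY vertex — self-dual (★ R2b, the residual conic) or of type two (★ R3, the residual projective line) — has exactly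
`q + 1` neighbours, `q = |𝓀[K]|`: the local index `(q+1, q+1)` of the ramified quasi-split `U(3)` (both vertices special). [cite: Tits1979, §2.4] [cite: BruhatTits1972, §10] [cite: Serre1980Trees, II.1.1] -/
theorem ncard_neighborSet_of_ramified (hσ : ∀ x, σ (σ x) = x) (hvσ : ∀ a, Valued.v (σ a) = Valued.v a) (hσϖ : σ ϖ = -ϖ) (hϖ : Valued.v ϖ = WithZero.exp (-1 : ℤ)) (hres : ∀ x : K, Valued.v x ≤ 1 → Valued.v (σ x - x) < 1) (h2 : Valued.v (2 : K) = 1) (hnorm : ∀ u : K, σ u = u → Valued.v (u - 1) < 1 → ∃ z : K, z * σ z = u ∧ Valued.v (z - 1) ≤ Valued.v (u - 1)) [Finite 𝓀[K]] (v : {M : Submodule 𝒪[K] (Fin 3 → K) // IsVertex σ ϖ ((StdForm.antidiagonal 3).over K) M}) :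
    ((latticeGraph σ ϖ ((StdForm.antidiagonal 3).over K)).neighborSet v).ncard = Nat.card 𝓀[K] + 1 := by
  by_cases hv : IsSelfDualLattice σ ϖ ((StdForm.antidiagonal 3).over K) v.1
  · exact ncard_neighborSet_of_isSelfDualLattice_of_ramified hσ hvσ hϖ hres h2 (isVertexLattice_two_N₁_of_neg hσϖ hϖ) v hv
  · exact ncard_neighborSet_of_isVertexLattice_two_of_ramified hσ hvσ hσϖ hϖ hres h2 hnorm v (isVertexLattice_two_of_not_isSelfDualLattice_of_v hvσ hϖ v hv)

/-- The `hdeg` plug of ★ `TreeDisplacementLayerCount` for the tame-ramified graph with the CONSTANT valency vector `(q, q)`: `#star(v) = q_{c v} + 1` for any type function `c`.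
[cite: Tits1979, §2.4] -/
theorem ncard_neighborSet_eq_typeFun_of_ramified (hσ : ∀ x, σ (σ x) = x) (hvσ : ∀ a, Valued.v (σ a) = Valued.v a) (hσϖ : σ ϖ = -ϖ) (hϖ : Valued.v ϖ = WithZero.exp (-1 : ℤ)) (hres : ∀ x : K, Valued.v x ≤ 1 → Valued.v (σ x - x) < 1) (h2 : Valued.v (2 : K) = 1) (hnorm : ∀ u : K, σ u = u → Valued.v (u - 1) < 1 → ∃ z : K, z * σ z = u ∧ Valued.v (z - 1) ≤ Valued.v (u - 1)) [Finite 𝓀[K]] (c : {M : Submodule 𝒪[K] (Fin 3 → K) // IsVertex σ ϖ ((StdForm.antidiagonal 3).over K) M} → Fin 2) (v : {M : Submodule 𝒪[K] (Fin 3 → K) // IsVertex σ ϖ ((StdForm.antidiagonal 3).over K) M}) :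
    ((latticeGraph σ ϖ ((StdForm.antidiagonal 3).over K)).neighborSet v).ncard = (![Nat.card 𝓀[K], Nat.card 𝓀[K]] : Fin 2 → ℕ) (c v) + 1 := by
  rw [ncard_neighborSet_of_ramified hσ hvσ hσϖ hϖ hres h2 hnorm v]
  rcases Fin.exists_fin_two.1 ⟨c v, rfl⟩ with h | h <;> rw [h] <;> rfl

/-! ## §3 The spheres of the tame-ramified tree (given tree-ness) -/

/-- **THE SPHERES OF THE TAME-RAMIFIED `U(3)` TREE**: for EVERY vertex `r` and `m ≥ 1`, `#{v | dist(r, v) = m} = (q + 1) · q^{m−1}`, `q = |𝓀[K]|` — GIVEN tree-ness `hT` (★ `isTree_latticeGraph_three`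
covers the unramified datum only; at a ramified place `hT` is a binder).  ★ `TreeDisplacement.ncard_sphere_eq_of_biregular'` with the constant valency vector `(q, q)`, and
`⌊m∕2⌋ + ⌊(m−1)∕2⌋ = m − 1`. [cite: Serre1980Trees, I.2.3] [cite: Serre1980Trees, II.1.1] [cite: Tits1979, §2.4] -/
theorem ncard_sphere_of_ramified (hσ : ∀ x, σ (σ x) = x) (hvσ : ∀ a, Valued.v (σ a) = Valued.v a) (hσϖ : σ ϖ = -ϖ) (hϖ : Valued.v ϖ = WithZero.exp (-1 : ℤ)) (hres : ∀ x : K, Valued.v x ≤ 1 → Valued.v (σ x - x) < 1) (h2 : Valued.v (2 : K) = 1) (hnorm : ∀ u : K, σ u = u → Valued.v (u - 1) < 1 → ∃ z : K, z * σ z = u ∧ Valued.v (z - 1) ≤ Valued.v (u - 1)) [Finite 𝓀[K]] (hT : (latticeGraph σ ϖ ((StdForm.antidiagonal 3).over K)).IsTree) (r : {M : Submodule 𝒪[K] (Fin 3 → K) // IsVertex σ ϖ ((StdForm.antidiagonal 3).over K) M}) {m : ℕ} (hm : 1 ≤ m) :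
    {v | (latticeGraph σ ϖ ((StdForm.antidiagonal 3).over K)).dist r v = m}.ncard = (Nat.card 𝓀[K] + 1) * Nat.card 𝓀[K] ^ (m - 1) := by
  obtain ⟨c, hc0⟩ := exists_typeFun (K := K) (σ := σ) (ϖ := ϖ)
  have hab : c r ≠ c r + 1 := by rcases Fin.exists_fin_two.1 ⟨c r, rfl⟩ with h | h <;> rw [h] <;> decide
  have h := TreeDisplacement.ncard_sphere_eq_of_biregular' hT (finite_neighborSet_of_ramified hσ hvσ hσϖ hϖ hres h2 hnorm) r c
    (typeFun_ne_of_adj_of_v hvσ hϖ hc0) ![Nat.card 𝓀[K], Nat.card 𝓀[K]] (ncard_neighborSet_eq_typeFun_of_ramified hσ hvσ hσϖ hϖ hres h2 hnorm c) rfl hab hm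
  have hq : ∀ i : Fin 2, (![Nat.card 𝓀[K], Nat.card 𝓀[K]] : Fin 2 → ℕ) i = Nat.card 𝓀[K] := fun i => by
    rcases Fin.exists_fin_two.1 ⟨i, rfl⟩ with h | h <;> rw [h] <;> rfl
  rw [h, hq, hq, mul_assoc, ← pow_add, show m / 2 + (m - 1) / 2 = m - 1 by omega]

/-- **`q² + q` VERTICES AT DISTANCE `2`** from any vertex of the tame-ramified tree (given `hT`). [cite: Serre1980Trees, I.2.3] [cite: Tits1979, §2.4] -/
theorem ncard_sphere_two_of_ramified (hσ : ∀ x, σ (σ x) = x) (hvσ : ∀ a, Valued.v (σ a) = Valued.v a) (hσϖ : σ ϖ = -ϖ) (hϖ : Valued.v ϖ = WithZero.exp (-1 : ℤ)) (hres : ∀ x : K, Valued.v x ≤ 1 → Valued.v (σ x - x) < 1) (h2 : Valued.v (2 : K) = 1) (hnorm : ∀ u : K, σ u = u → Valued.v (u - 1) < 1 → ∃ z : K, z * σ z = u ∧ Valued.v (z - 1) ≤ Valued.v (u - 1)) [Finite 𝓀[K]] (hT : (latticeGraph σ ϖ ((StdForm.antidiagonal 3).over K)).IsTree) (r : {M :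 Submodule 𝒪[K] (Fin 3 → K) // IsVertex σ ϖ ((StdForm.antidiagonal 3).over K) M}) :
    {v | (latticeGraph σ ϖ ((StdForm.antidiagonal 3).over K)).dist r v = 2}.ncard = Nat.card 𝓀[K] ^ 2 + Nat.card 𝓀[K] := by
  rw [ncard_sphere_of_ramified hσ hvσ hσϖ hϖ hres h2 hnorm hT r (by norm_num : 1 ≤ 2)]
  ring

end Literature.NumberTheory.Automorphic.UnitaryLatticeTree

end
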